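import Summits.NavierStokesRegularity.NavierStokesRegularity.Theorems.CoriolisHeadLocalEnergyDensityStep
import HarnessLib

/-!
# CoriolisHeadLocalEnergyDensityBootstrap — crux `NoCoRotatingCore` (stmt-NavierStokesRegularity-22676), line
# `local_energy_rescue` (crux workfile, ns-idea-10 g3), stub S2 `stub_densityBootstrap` — file 3: the two bootstrap rounds
# for a Pineau–Vicol profile

For a smooth bounded Pineau–Vicol profile `(V, Q)` (`ν = 1`, `a = ½`, `B = αJ`) whose pressure has bounded mean oscillation
`∫_{B(z,ρ)}(Q − m)² ≤ Kρ³`, the local energy `F(ρ) = sup_z ∫_{B(z,ρ)}‖V‖²` improves from the trivial `F ≤ M²|B₁|ρ³` to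
`F ≤ A₁ρ²` (`density_round_one`, gauge weight `τ = 1`) and then to `F ≤ A₂ρ^{3/2}` (`density_round_two`, `τ = ρ^{−1/2}`),
i.e. `β = 3/2 > 1` (`density_three_halves`).  Each round is the one-step inequality `energy_step` of file 2 with the flux
majorised by `D(√(−s))⁻³`, resp. `D(√(−s))⁻²(√√(−s))⁻¹`, whose time integrals over `[−1, −ρ⁻²]` are `≤ 2ρ`, resp.
`≤ 4√ρ` (`integral_inv_sqrt_cube_le`, `integral_inv_sq_inv_sqrt_sqrt_le`, by their antiderivatives `2/√(−s)`, `4/√√(−s)`).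
The `BMO₂`-only pressure term is what stops the exponent at `β' = 1 + β/2` per round (fixed point `2`), as the line card says.

HONEST FRAMING.  Helper for an unregistered line's stub; nothing here proves `NoCoRotatingCore` or NS regularity.

References: D. Chae, J. Wolf, arXiv:1610.09464, §2 Step 2 (2.4c)–(2.4g) [ChaeWolf2017RemovingDSS]; line card
`Lines/local_energy_rescue.md` (S2 `stub_densityBootstrap`).
-/

noncomputable section

open MeasureTheory Set Function Filter Topology Metric InnerProductSpace Real
open scoped RealInnerProductSpace Laplacian ContDiff Topology

-- the summit and its single sub-problem share the name (CONVENTIONS §1), as in every Theorems file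
set_option linter.dupNamespace false

namespace Summit.NavierStokesRegularity.NavierStokesRegularity.Theorems.CoriolisHead

namespace LocalEnergyRescue

open Literature.Analysis.FluidPDE

/-! ## §7 Two explicit time integrals -/

/-- `d/ds √(−s) = −1/(2√(−s))` for `s < 0`. [folklore] -/
theorem hasDerivAt_sqrt_neg {s : ℝ} (hs : s < 0) :
    HasDerivAt (fun s : ℝ => Real.sqrt (-s)) (-1 / (2 * Real.sqrt (-s))) s := by
  have h := (hasDerivAt_neg s).sqrt (by linarith : -s ≠ 0)
  convert h using 1

/-- `∫_{−1}^{t₁} (√(−s))⁻³ ds ≤ 2/√(−t₁)` for `t₁ ∈ [−1, 0)` (antiderivative `2/√(−s)`). [folklore] -/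
theorem integral_inv_sqrt_cube_le {t₁ : ℝ} (ht₁ : -1 ≤ t₁) (ht₁0 : t₁ < 0) :
    ∫ s in (-1 : ℝ)..t₁, ((Real.sqrt (-s))⁻¹) ^ 3 ≤ 2 * (Real.sqrt (-t₁))⁻¹ := by
  have hderiv : ∀ s ∈ uIcc (-1 : ℝ) t₁,
      HasDerivAt (fun s : ℝ => 2 * (Real.sqrt (-s))⁻¹) (((Real.sqrt (-s))⁻¹) ^ 3) s := by
    intro s hs
    rw [uIcc_of_le ht₁] at hs
    have hs0 : s < 0 := lt_of_le_of_lt hs.2 ht₁0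
    have ha : 0 < Real.sqrt (-s) := Real.sqrt_pos.2 (by linarith)
    have h := ((hasDerivAt_sqrt_neg hs0).inv ha.ne').const_mul 2
    refine h.congr_deriv ?_
    rw [inv_pow]
    field_simp
  have hcont : ContinuousOn (fun s : ℝ => ((Real.sqrt (-s))⁻¹) ^ 3) (uIcc (-1 : ℝ) t₁) := by
    rw [uIcc_of_le ht₁]
    refine ContinuousOn.pow (ContinuousOn.inv₀ (Real.continuous_sqrt.comp continuous_neg).continuousOn
      fun s hs => ?_) 3
    exact (Real.sqrt_pos.2 (by linarith [lt_of_le_of_lt hs.2 ht₁0])).ne'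
  rw [intervalIntegral.integral_eq_sub_of_hasDerivAt hderiv (hcont.intervalIntegrable)]
  simp only [neg_neg, Real.sqrt_one, inv_one, mul_one]
  linarith

/-- `∫_{−1}^{t₁} (√(−s))⁻²(√√(−s))⁻¹ ds ≤ 4/√√(−t₁)` for `t₁ ∈ [−1, 0)` (antiderivative `4/√√(−s)`). [folklore] -/
theorem integral_inv_sq_inv_sqrt_sqrt_le {t₁ : ℝ} (ht₁ : -1 ≤ t₁) (ht₁0 : t₁ < 0) :
    ∫ s in (-1 : ℝ)..t₁, ((Real.sqrt (-s))⁻¹) ^ 2 * (Real.sqrt (Real.sqrt (-s)))⁻¹ ≤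
      4 * (Real.sqrt (Real.sqrt (-t₁)))⁻¹ := by
  have hderiv : ∀ s ∈ uIcc (-1 : ℝ) t₁,
      HasDerivAt (fun s : ℝ => 4 * (Real.sqrt (Real.sqrt (-s)))⁻¹)
        (((Real.sqrt (-s))⁻¹) ^ 2 * (Real.sqrt (Real.sqrt (-s)))⁻¹) s := by
    intro s hs
    rw [uIcc_of_le ht₁] at hs
    have hs0 : s < 0 := lt_of_le_of_lt hs.2 ht₁0
    have ha : 0 < Real.sqrt (-s) := Real.sqrt_pos.2 (by linarith)
    have hb : 0 < Real.sqrt (Real.sqrt (-s)) := Real.sqrt_pos.2 ha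
    have hb2 : Real.sqrt (Real.sqrt (-s)) ^ 2 = Real.sqrt (-s) := Real.sq_sqrt ha.le
    have h := (((hasDerivAt_sqrt_neg hs0).sqrt ha.ne').inv hb.ne').const_mul 4
    refine h.congr_deriv ?_
    rw [inv_pow, hb2]
    field_simp
    norm_num
  have hcont : ContinuousOn (fun s : ℝ => ((Real.sqrt (-s))⁻¹) ^ 2 * (Real.sqrt (Real.sqrt (-s)))⁻¹)
      (uIcc (-1 : ℝ) t₁) := by
    rw [uIcc_of_le ht₁]
    have hsq : Continuous fun s : ℝ => Real.sqrt (-s) := Real.continuous_sqrt.comp continuous_neg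
    have hne : ∀ s ∈ Icc (-1 : ℝ) t₁, Real.sqrt (-s) ≠ 0 := fun s hs =>
      (Real.sqrt_pos.2 (by linarith [lt_of_le_of_lt hs.2 ht₁0])).ne'
    refine ((ContinuousOn.inv₀ hsq.continuousOn hne).pow 2).mul
      (ContinuousOn.inv₀ (Real.continuous_sqrt.comp hsq).continuousOn fun s hs => ?_)
    exact (Real.sqrt_pos.2 (Real.sqrt_pos.2 (by linarith [lt_of_le_of_lt hs.2 ht₁0]))).ne'
  rw [intervalIntegral.integral_eq_sub_of_hasDerivAt hderiv (hcont.intervalIntegrable)]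
  simp only [neg_neg, Real.sqrt_one, inv_one, mul_one]
  linarith

/-! ## §8 The two bootstrap rounds for a Pineau–Vicol profile -/

section Rounds

variable {α : ℝ} {V : EuclideanSpace ℝ (Fin 3) → EuclideanSpace ℝ (Fin 3)}
  {Q : EuclideanSpace ℝ (Fin 3) → ℝ}

/-- The trivial round-zero bound: `∫_{B(z,ρ)} ‖V‖² ≤ M²|B₁| ρ³`. [folklore] -/
theorem setIntegral_ball_norm_sq_le_cube {M : ℝ} (hM : ∀ y, ‖V y‖ ≤ M) (z : EuclideanSpace ℝ (Fin 3))
    {ρ : ℝ} (hρ : 0 < ρ) :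
    ∫ y in ball z ρ, ‖V y‖ ^ 2 ≤ M ^ 2 * (volume (ball (0 : EuclideanSpace ℝ (Fin 3)) 1)).toReal * ρ ^ 3 := by
  have h := norm_setIntegral_le_of_norm_le_const (measure_ball_lt_top (μ := volume) (x := z) (r := ρ))
    (f := fun y => ‖V y‖ ^ 2) (C := M ^ 2) fun y _ => by
      rw [norm_pow, norm_norm]
      exact pow_le_pow_left₀ (norm_nonneg _) (hM y) 2
  have hvol : volume.real (ball z ρ) = ρ ^ 3 * (volume (ball (0 : EuclideanSpace ℝ (Fin 3)) 1)).toReal := by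
    rw [measureReal_def, Measure.addHaar_ball volume z hρ.le, finrank_euclideanSpace_fin,
      ENNReal.toReal_mul, ENNReal.toReal_ofReal (by positivity)]
  rw [hvol] at h
  have h' := (le_abs_self _).trans ((Real.norm_eq_abs _).symm.le.trans h)
  nlinarith [h']

/-- **Round one (β = 1): `∫_{B(z,ρ)} ‖V‖² ≤ A₁ ρ²` for `ρ ≥ 1`** if the pressure has bounded mean oscillation
`∫_{B(z,ρ)}(Q − m)² ≤ Kρ³`. [cite: ChaeWolf2017RemovingDSS, §2 Step 2 (2.4c) (arXiv p. 5)] -/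
theorem density_round_one (hV : ContDiff ℝ ∞ V) (hQ : ContDiff ℝ ∞ Q) (hdiv : VectorCalculus.IsDivFree V)
    (heq : ∀ y : EuclideanSpace ℝ (Fin 3), α • (rotGen (V y) - fderiv ℝ V y (rotGen y)) +
      (1 / 2 : ℝ) • V y + (1 / 2 : ℝ) • fderiv ℝ V y y - (Δ V) y + fderiv ℝ V y (V y) +
      gradient Q y = 0)
    {M : ℝ} (hM : ∀ y, ‖V y‖ ≤ M) {K : ℝ}
    (hP : ∀ (z : EuclideanSpace ℝ (Fin 3)) (ρ : ℝ), 0 < ρ →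
      ∃ m : ℝ, ∫ y in ball z ρ, (Q y - m) ^ 2 ≤ K * ρ ^ 3) :
    ∃ A₁ : ℝ, 0 ≤ A₁ ∧ ∀ (z : EuclideanSpace ℝ (Fin 3)) (ρ : ℝ), 1 ≤ ρ →
      ∫ y in ball z ρ, ‖V y‖ ^ 2 ≤ A₁ * ρ ^ 2 := by
  have hM0 : 0 ≤ M := (norm_nonneg _).trans (hM 0)
  set W : ℝ := (volume (ball (0 : EuclideanSpace ℝ (Fin 3)) 1)).toReal with hW
  set A : ℝ := M ^ 2 * W with hA
  have hA0 : 0 ≤ A := by positivity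
  have hK0 : 0 ≤ K := by
    obtain ⟨m, hm⟩ := hP 0 1 one_pos
    have h0 : 0 ≤ ∫ y in ball (0 : EuclideanSpace ℝ (Fin 3)) 1, (Q y - m) ^ 2 :=
      setIntegral_nonneg measurableSet_ball fun y _ => sq_nonneg _
    linarith
  have hI : ∀ (z : EuclideanSpace ℝ (Fin 3)) (ρ : ℝ), 1 ≤ ρ → ∫ y in ball z ρ, ‖V y‖ ^ 2 ≤ A * ρ ^ 3 :=
    fun z ρ hρ => (setIntegral_ball_norm_sq_le_cube hM z (by linarith)).trans (le_of_eq (by rw [hA]))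
  -- the gauged pressure flux, `τ = 1`
  have hJ : ∀ (z : EuclideanSpace ℝ (Fin 3)) (ρ : ℝ), 1 ≤ ρ →
      ∃ m : ℝ, ∫ y in ball z ρ, |Q y - m| * ‖V y‖ ≤ (K + A) / 2 * ρ ^ 3 := by
    intro z ρ hρ
    obtain ⟨m, hm⟩ := hP z ρ (by linarith)
    refine ⟨m, (setIntegral_abs_sub_mul_norm_le hQ.continuous hV.continuous z ρ m one_pos).trans ?_⟩
    have h2 := hI z ρ hρ
    nlinarith [hm, h2]
  obtain ⟨R, B, hR1, hB0, hstep⟩ := energy_step (α := α) hV hQ hdiv heq hM (n := 3) hI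
    (J := fun ρ => (K + A) / 2 * ρ ^ 3) (by fun_prop) hJ
  set D₁ : ℝ := B * (A * R ^ 3) + B * (M * (A * R ^ 3)) + B * ((K + A) * R ^ 3) with hD₁
  have hD₁0 : 0 ≤ D₁ := by positivity
  refine ⟨B * (A * R ^ 3) + 2 * D₁, by positivity, fun z ρ hρ => ?_⟩
  have hρ0 : 0 < ρ := by linarith
  -- the time `t₁ = −ρ⁻²`
  set t₁ : ℝ := -(ρ⁻¹) ^ 2 with ht₁
  have ht₁0 : t₁ < 0 := by rw [ht₁]; exact neg_neg_of_pos (by positivity)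
  have ht₁1 : -1 ≤ t₁ := by
    rw [ht₁, neg_le_neg_iff]
    have : ρ⁻¹ ≤ 1 := inv_le_one_of_one_le₀ hρ
    have : 0 ≤ ρ⁻¹ := by positivity
    nlinarith
  have hsq : Real.sqrt (-t₁) = ρ⁻¹ := by
    rw [ht₁, neg_neg, Real.sqrt_sq (by positivity)]
  have h := hstep z t₁ ht₁1 ht₁0
  rw [hsq, one_div, inv_inv] at h
  -- the time integral
  have hmaj : ∀ s ∈ Icc (-1 : ℝ) t₁,
      B * (Real.sqrt (-s) * (A * (R / Real.sqrt (-s)) ^ 3)) + B * (M * (A * (R / Real.sqrt (-s)) ^ 3)) +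
        2 * B * ((K + A) / 2 * (R / Real.sqrt (-s)) ^ 3) ≤ D₁ * ((Real.sqrt (-s))⁻¹) ^ 3 := by
    intro s hs
    have hs0 : s < 0 := lt_of_le_of_lt hs.2 ht₁0
    have ha : 0 < Real.sqrt (-s) := Real.sqrt_pos.2 (by linarith)
    have ha1 : Real.sqrt (-s) ≤ 1 := by
      rw [show (1 : ℝ) = Real.sqrt 1 by simp]; exact Real.sqrt_le_sqrt (by linarith [hs.1])
    set q : ℝ := (Real.sqrt (-s))⁻¹ with hq
    have hq1 : 1 ≤ q := by rw [hq]; exact one_le_inv_iff₀.2 ⟨ha, ha1⟩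
    have e1 : (R / Real.sqrt (-s)) ^ 3 = R ^ 3 * q ^ 3 := by rw [hq, div_eq_mul_inv, mul_pow]
    have e2 : Real.sqrt (-s) * (A * (R ^ 3 * q ^ 3)) = A * R ^ 3 * q ^ 2 := by
      rw [hq]; field_simp
    rw [e1, e2]
    have hq23 : q ^ 2 ≤ q ^ 3 := by nlinarith
    have hAR : 0 ≤ A * R ^ 3 := by positivity
    rw [hD₁]
    nlinarith [mul_le_mul_of_nonneg_left hq23 (mul_nonneg hB0 hAR)]
  have hcq : ContinuousOn (fun s : ℝ => D₁ * ((Real.sqrt (-s))⁻¹) ^ 3) (uIcc (-1 : ℝ) t₁) := by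
    rw [uIcc_of_le ht₁1]
    refine continuousOn_const.mul (ContinuousOn.pow (ContinuousOn.inv₀
      (Real.continuous_sqrt.comp continuous_neg).continuousOn fun s hs => ?_) 3)
    exact (Real.sqrt_pos.2 (by linarith [lt_of_le_of_lt hs.2 ht₁0])).ne'
  have hcg : ContinuousOn (fun s : ℝ => B * (Real.sqrt (-s) * (A * (R / Real.sqrt (-s)) ^ 3)) +
      B * (M * (A * (R / Real.sqrt (-s)) ^ 3)) + 2 * B * ((K + A) / 2 * (R / Real.sqrt (-s)) ^ 3))
      (uIcc (-1 : ℝ) t₁) := by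
    rw [uIcc_of_le ht₁1]
    have hsq' : ContinuousOn (fun s : ℝ => Real.sqrt (-s)) (Icc (-1) t₁) :=
      (Real.continuous_sqrt.comp continuous_neg).continuousOn
    have hne : ∀ s ∈ Icc (-1 : ℝ) t₁, Real.sqrt (-s) ≠ 0 := fun s hs =>
      (Real.sqrt_pos.2 (by linarith [lt_of_le_of_lt hs.2 ht₁0])).ne'
    have hd : ContinuousOn (fun s : ℝ => R / Real.sqrt (-s)) (Icc (-1) t₁) := continuousOn_const.div hsq' hne
    fun_prop (disch := assumption)
  have hInt := intervalIntegral.integral_mono_on ht₁1 (hcg.intervalIntegrable (μ := volume))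
    (hcq.intervalIntegrable (μ := volume)) hmaj
  have hI3 := integral_inv_sqrt_cube_le ht₁1 ht₁0
  rw [hsq, inv_inv] at hI3
  have hconst : ∫ s in (-1 : ℝ)..t₁, D₁ * ((Real.sqrt (-s))⁻¹) ^ 3 =
      D₁ * ∫ s in (-1 : ℝ)..t₁, ((Real.sqrt (-s))⁻¹) ^ 3 := intervalIntegral.integral_const_mul _ _
  rw [hconst] at hInt
  -- assemble: `ρ⁻¹ X ≤ BAR³ + 2 D₁ ρ`
  have hD3 := mul_le_mul_of_nonneg_left hI3 hD₁0
  have hX : ρ⁻¹ * ∫ y in ball z ρ, ‖V y‖ ^ 2 ≤ B * (A * R ^ 3) + D₁ * (2 * ρ) := by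
    linarith [h, hInt, hD3]
  have hX' : ∫ y in ball z ρ, ‖V y‖ ^ 2 ≤ ρ * (B * (A * R ^ 3) + D₁ * (2 * ρ)) := by
    have := mul_le_mul_of_nonneg_left hX hρ0.le
    rwa [← mul_assoc, mul_inv_cancel₀ hρ0.ne', one_mul] at this
  have hBAR : 0 ≤ B * (A * R ^ 3) := by positivity
  have hlast := mul_le_mul_of_nonneg_left hρ hBAR
  have e5 : (B * (A * R ^ 3) + 2 * D₁) * ρ ^ 2 = B * (A * R ^ 3) * ρ * ρ + ρ * (D₁ * (2 * ρ)) := by ring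
  rw [e5]
  nlinarith [hX', hlast, hρ0]

/-- **Round two (β = 3/2): `∫_{B(z,ρ)} ‖V‖² ≤ A₂ ρ√ρ` for `ρ ≥ 1`** from round one and `BMO₂` of the pressure
(gauge weight `τ = ρ^{−1/2}` in the pressure flux). [cite: ChaeWolf2017RemovingDSS, §2 Step 2 (arXiv p. 5)] -/
theorem density_round_two (hV : ContDiff ℝ ∞ V) (hQ : ContDiff ℝ ∞ Q) (hdiv : VectorCalculus.IsDivFree V)
    (heq : ∀ y : EuclideanSpace ℝ (Fin 3), α • (rotGen (V y) - fderiv ℝ V y (rotGen y)) +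
      (1 / 2 : ℝ) • V y + (1 / 2 : ℝ) • fderiv ℝ V y y - (Δ V) y + fderiv ℝ V y (V y) +
      gradient Q y = 0)
    {M : ℝ} (hM : ∀ y, ‖V y‖ ≤ M) {K : ℝ}
    (hP : ∀ (z : EuclideanSpace ℝ (Fin 3)) (ρ : ℝ), 0 < ρ →
      ∃ m : ℝ, ∫ y in ball z ρ, (Q y - m) ^ 2 ≤ K * ρ ^ 3)
    {A₁ : ℝ} (hA₁ : 0 ≤ A₁)
    (hI : ∀ (z : EuclideanSpace ℝ (Fin 3)) (ρ : ℝ), 1 ≤ ρ → ∫ y in ball z ρ, ‖V y‖ ^ 2 ≤ A₁ * ρ ^ 2) :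
    ∃ A₂ : ℝ, 0 ≤ A₂ ∧ ∀ (z : EuclideanSpace ℝ (Fin 3)) (ρ : ℝ), 1 ≤ ρ →
      ∫ y in ball z ρ, ‖V y‖ ^ 2 ≤ A₂ * (ρ * Real.sqrt ρ) := by
  have hM0 : 0 ≤ M := (norm_nonneg _).trans (hM 0)
  have hK0 : 0 ≤ K := by
    obtain ⟨m, hm⟩ := hP 0 1 one_pos
    have h0 : 0 ≤ ∫ y in ball (0 : EuclideanSpace ℝ (Fin 3)) 1, (Q y - m) ^ 2 :=
      setIntegral_nonneg measurableSet_ball fun y _ => sq_nonneg _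
    linarith
  -- the gauged pressure flux, `τ = 1/√ρ`
  have hJ : ∀ (z : EuclideanSpace ℝ (Fin 3)) (ρ : ℝ), 1 ≤ ρ →
      ∃ m : ℝ, ∫ y in ball z ρ, |Q y - m| * ‖V y‖ ≤ (K + A₁) / 2 * (ρ ^ 2 * Real.sqrt ρ) := by
    intro z ρ hρ
    have hρ0 : 0 < ρ := by linarith
    obtain ⟨m, hm⟩ := hP z ρ hρ0
    have h2 := hI z ρ hρ
    set r : ℝ := Real.sqrt ρ with hrdef
    have hr : 0 < r := Real.sqrt_pos.2 hρ0
    have hr2 : r ^ 2 = ρ := Real.sq_sqrt hρ0.le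
    refine ⟨m, (setIntegral_abs_sub_mul_norm_le hQ.continuous hV.continuous z ρ m
      (inv_pos.2 hr)).trans ?_⟩
    have e : r⁻¹ / 2 * (K * ρ ^ 3) + 1 / (2 * r⁻¹) * (A₁ * ρ ^ 2) =
        (K + A₁) / 2 * (ρ ^ 2 * r) := by
      rw [← hr2]
      field_simp
    have t1 : r⁻¹ / 2 * ∫ y in ball z ρ, (Q y - m) ^ 2 ≤ r⁻¹ / 2 * (K * ρ ^ 3) :=
      mul_le_mul_of_nonneg_left hm (by positivity)
    have t2 : 1 / (2 * r⁻¹) * ∫ y in ball z ρ, ‖V y‖ ^ 2 ≤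
        1 / (2 * r⁻¹) * (A₁ * ρ ^ 2) := mul_le_mul_of_nonneg_left h2 (by positivity)
    linarith
  obtain ⟨R, B, hR1, hB0, hstep⟩ := energy_step (α := α) hV hQ hdiv heq hM (n := 2) hI
    (J := fun ρ => (K + A₁) / 2 * (ρ ^ 2 * Real.sqrt ρ)) (by fun_prop) hJ
  set D₂ : ℝ := B * (A₁ * R ^ 2) + B * (M * (A₁ * R ^ 2)) + B * ((K + A₁) * (R ^ 2 * Real.sqrt R)) with hD₂
  have hD₂0 : 0 ≤ D₂ := by positivity
  refine ⟨B * (A₁ * R ^ 2) + 4 * D₂, by positivity, fun z ρ hρ => ?_⟩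
  have hρ0 : 0 < ρ := by linarith
  have hrρ : 0 < Real.sqrt ρ := Real.sqrt_pos.2 hρ0
  have hrρ1 : 1 ≤ Real.sqrt ρ := by
    rw [show (1 : ℝ) = Real.sqrt 1 by simp]; exact Real.sqrt_le_sqrt hρ
  -- the time `t₁ = −ρ⁻²`
  set t₁ : ℝ := -(ρ⁻¹) ^ 2 with ht₁
  have ht₁0 : t₁ < 0 := by rw [ht₁]; exact neg_neg_of_pos (by positivity)
  have ht₁1 : -1 ≤ t₁ := by
    rw [ht₁, neg_le_neg_iff]
    have : ρ⁻¹ ≤ 1 := inv_le_one_of_one_le₀ hρ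
    have : 0 ≤ ρ⁻¹ := by positivity
    nlinarith
  have hsq : Real.sqrt (-t₁) = ρ⁻¹ := by
    rw [ht₁, neg_neg, Real.sqrt_sq (by positivity)]
  have hsq2 : Real.sqrt (Real.sqrt (-t₁)) = (Real.sqrt ρ)⁻¹ := by
    rw [hsq, Real.sqrt_inv]
  have h := hstep z t₁ ht₁1 ht₁0
  rw [hsq, one_div, inv_inv] at h
  -- the majorant `D₂ q² b⁻¹`
  have hmaj : ∀ s ∈ Icc (-1 : ℝ) t₁,
      B * (Real.sqrt (-s) * (A₁ * (R / Real.sqrt (-s)) ^ 2)) + B * (M * (A₁ * (R / Real.sqrt (-s)) ^ 2)) +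
        2 * B * ((K + A₁) / 2 * ((R / Real.sqrt (-s)) ^ 2 * Real.sqrt (R / Real.sqrt (-s)))) ≤
        D₂ * (((Real.sqrt (-s))⁻¹) ^ 2 * (Real.sqrt (Real.sqrt (-s)))⁻¹) := by
    intro s hs
    have hs0 : s < 0 := lt_of_le_of_lt hs.2 ht₁0
    have ha : 0 < Real.sqrt (-s) := Real.sqrt_pos.2 (by linarith)
    have ha1 : Real.sqrt (-s) ≤ 1 := by
      rw [show (1 : ℝ) = Real.sqrt 1 by simp]; exact Real.sqrt_le_sqrt (by linarith [hs.1])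
    set q : ℝ := (Real.sqrt (-s))⁻¹ with hq
    have hq1 : 1 ≤ q := by rw [hq]; exact one_le_inv_iff₀.2 ⟨ha, ha1⟩
    set b : ℝ := Real.sqrt (Real.sqrt (-s)) with hb
    have hbpos : 0 < b := Real.sqrt_pos.2 ha
    have hb1 : b ≤ 1 := by
      rw [hb, show (1 : ℝ) = Real.sqrt 1 by simp]; exact Real.sqrt_le_sqrt ha1
    have hbi1 : 1 ≤ b⁻¹ := one_le_inv_iff₀.2 ⟨hbpos, hb1⟩
    have e1 : (R / Real.sqrt (-s)) ^ 2 = R ^ 2 * q ^ 2 := by rw [hq, div_eq_mul_inv, mul_pow]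
    have e2 : Real.sqrt (-s) * (A₁ * (R ^ 2 * q ^ 2)) = A₁ * R ^ 2 * q := by
      rw [hq]; field_simp
    have e3 : Real.sqrt (R / Real.sqrt (-s)) = Real.sqrt R * b⁻¹ := by
      rw [div_eq_mul_inv, Real.sqrt_mul' _ (inv_nonneg.2 ha.le), Real.sqrt_inv, hb]
    rw [e1, e2, e3]
    have hAR : 0 ≤ A₁ * R ^ 2 := by positivity
    have hq2 : q ≤ q ^ 2 * b⁻¹ := by
      calc q = q * 1 * 1 := by ring
        _ ≤ q * q * b⁻¹ := by gcongr
        _ = q ^ 2 * b⁻¹ := by ring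
    have hq3 : q ^ 2 ≤ q ^ 2 * b⁻¹ := by
      calc q ^ 2 = q ^ 2 * 1 := by ring
        _ ≤ q ^ 2 * b⁻¹ := by gcongr
    rw [hD₂]
    have t1 : B * (A₁ * R ^ 2 * q) ≤ B * (A₁ * R ^ 2) * (q ^ 2 * b⁻¹) := by
      calc B * (A₁ * R ^ 2 * q) = B * (A₁ * R ^ 2) * q := by ring
        _ ≤ B * (A₁ * R ^ 2) * (q ^ 2 * b⁻¹) := mul_le_mul_of_nonneg_left hq2 (by positivity)
    have t2 : B * (M * (A₁ * (R ^ 2 * q ^ 2))) ≤ B * (M * (A₁ * R ^ 2)) * (q ^ 2 * b⁻¹) := by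
      calc B * (M * (A₁ * (R ^ 2 * q ^ 2))) = B * (M * (A₁ * R ^ 2)) * q ^ 2 := by ring
        _ ≤ B * (M * (A₁ * R ^ 2)) * (q ^ 2 * b⁻¹) := mul_le_mul_of_nonneg_left hq3 (by positivity)
    have t3 : 2 * B * ((K + A₁) / 2 * (R ^ 2 * q ^ 2 * (Real.sqrt R * b⁻¹))) =
        B * ((K + A₁) * (R ^ 2 * Real.sqrt R)) * (q ^ 2 * b⁻¹) := by ring
    have e4 : (B * (A₁ * R ^ 2) + B * (M * (A₁ * R ^ 2)) + B * ((K + A₁) * (R ^ 2 * Real.sqrt R))) *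
        (q ^ 2 * b⁻¹) = B * (A₁ * R ^ 2) * (q ^ 2 * b⁻¹) + B * (M * (A₁ * R ^ 2)) * (q ^ 2 * b⁻¹) +
        B * ((K + A₁) * (R ^ 2 * Real.sqrt R)) * (q ^ 2 * b⁻¹) := by ring
    rw [e4]
    linarith [t1, t2, t3]
  have hne : ∀ s ∈ Icc (-1 : ℝ) t₁, Real.sqrt (-s) ≠ 0 := fun s hs =>
    (Real.sqrt_pos.2 (by linarith [lt_of_le_of_lt hs.2 ht₁0])).ne'
  have hne2 : ∀ s ∈ Icc (-1 : ℝ) t₁, Real.sqrt (Real.sqrt (-s)) ≠ 0 := fun s hs =>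
    (Real.sqrt_pos.2 (Real.sqrt_pos.2 (by linarith [lt_of_le_of_lt hs.2 ht₁0]))).ne'
  have hsq' : ContinuousOn (fun s : ℝ => Real.sqrt (-s)) (Icc (-1) t₁) :=
    (Real.continuous_sqrt.comp continuous_neg).continuousOn
  have hcq : ContinuousOn (fun s : ℝ => D₂ * (((Real.sqrt (-s))⁻¹) ^ 2 * (Real.sqrt (Real.sqrt (-s)))⁻¹))
      (uIcc (-1 : ℝ) t₁) := by
    rw [uIcc_of_le ht₁1]
    exact continuousOn_const.mul (((ContinuousOn.inv₀ hsq' hne).pow 2).mul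
      (ContinuousOn.inv₀ (Real.continuous_sqrt.comp_continuousOn hsq') hne2))
  have hcg : ContinuousOn (fun s : ℝ => B * (Real.sqrt (-s) * (A₁ * (R / Real.sqrt (-s)) ^ 2)) +
      B * (M * (A₁ * (R / Real.sqrt (-s)) ^ 2)) +
      2 * B * ((K + A₁) / 2 * ((R / Real.sqrt (-s)) ^ 2 * Real.sqrt (R / Real.sqrt (-s)))))
      (uIcc (-1 : ℝ) t₁) := by
    rw [uIcc_of_le ht₁1]
    have hd : ContinuousOn (fun s : ℝ => R / Real.sqrt (-s)) (Icc (-1) t₁) := continuousOn_const.div hsq' hne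
    have hd2 : ContinuousOn (fun s : ℝ => Real.sqrt (R / Real.sqrt (-s))) (Icc (-1) t₁) :=
      Real.continuous_sqrt.comp_continuousOn hd
    fun_prop (disch := assumption)
  have hInt := intervalIntegral.integral_mono_on ht₁1 (hcg.intervalIntegrable (μ := volume))
    (hcq.intervalIntegrable (μ := volume)) hmaj
  have hI4 := integral_inv_sq_inv_sqrt_sqrt_le ht₁1 ht₁0
  rw [hsq2, inv_inv] at hI4
  have hconst : ∫ s in (-1 : ℝ)..t₁, D₂ * (((Real.sqrt (-s))⁻¹) ^ 2 * (Real.sqrt (Real.sqrt (-s)))⁻¹) =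
      D₂ * ∫ s in (-1 : ℝ)..t₁, ((Real.sqrt (-s))⁻¹) ^ 2 * (Real.sqrt (Real.sqrt (-s)))⁻¹ :=
    intervalIntegral.integral_const_mul _ _
  rw [hconst] at hInt
  -- assemble: `ρ⁻¹ X ≤ B A₁ R² + 4 D₂ √ρ`
  have hD4 := mul_le_mul_of_nonneg_left hI4 hD₂0
  have hX : ρ⁻¹ * ∫ y in ball z ρ, ‖V y‖ ^ 2 ≤ B * (A₁ * R ^ 2) + D₂ * (4 * Real.sqrt ρ) := by
    linarith [h, hInt, hD4]
  have hX' : ∫ y in ball z ρ, ‖V y‖ ^ 2 ≤ ρ * (B * (A₁ * R ^ 2) + D₂ * (4 * Real.sqrt ρ)) := by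
    have := mul_le_mul_of_nonneg_left hX hρ0.le
    rwa [← mul_assoc, mul_inv_cancel₀ hρ0.ne', one_mul] at this
  have hBAR : 0 ≤ B * (A₁ * R ^ 2) := by positivity
  have hρr : ρ ≤ ρ * Real.sqrt ρ := by nlinarith
  have hlast := mul_le_mul_of_nonneg_left hρr hBAR
  have e5 : (B * (A₁ * R ^ 2) + 4 * D₂) * (ρ * Real.sqrt ρ) =
      B * (A₁ * R ^ 2) * (ρ * Real.sqrt ρ) + ρ * (D₂ * (4 * Real.sqrt ρ)) := by ring
  rw [e5]
  linarith [hX', hlast]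

/-- **Sub-volume energy density for Pineau–Vicol profiles (β = 3/2)**: a bounded smooth profile whose pressure has
bounded mean oscillation `∫_{B(z,ρ)}(Q − m)² ≤ Kρ³` satisfies `∫_{B(z,ρ)} ‖V‖² ≤ A₂ ρ^{3/2}` for all `ρ ≥ 1` (two
rounds of the energy bootstrap). [cite: ChaeWolf2017RemovingDSS, §2 Step 2 (arXiv p. 5)] -/
theorem density_three_halves (hV : ContDiff ℝ ∞ V) (hQ : ContDiff ℝ ∞ Q) (hdiv : VectorCalculus.IsDivFree V)
    (heq : ∀ y : EuclideanSpace ℝ (Fin 3), α • (rotGen (V y) - fderiv ℝ V y (rotGen y)) +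
      (1 / 2 : ℝ) • V y + (1 / 2 : ℝ) • fderiv ℝ V y y - (Δ V) y + fderiv ℝ V y (V y) +
      gradient Q y = 0)
    {M : ℝ} (hM : ∀ y, ‖V y‖ ≤ M) {K : ℝ}
    (hP : ∀ (z : EuclideanSpace ℝ (Fin 3)) (ρ : ℝ), 0 < ρ →
      ∃ m : ℝ, ∫ y in ball z ρ, (Q y - m) ^ 2 ≤ K * ρ ^ 3) :
    ∃ A₂ : ℝ, 0 ≤ A₂ ∧ ∀ (z : EuclideanSpace ℝ (Fin 3)) (ρ : ℝ), 1 ≤ ρ →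
      ∫ y in ball z ρ, ‖V y‖ ^ 2 ≤ A₂ * (ρ * Real.sqrt ρ) := by
  obtain ⟨A₁, hA₁, hI⟩ := density_round_one (α := α) hV hQ hdiv heq hM hP
  exact density_round_two (α := α) hV hQ hdiv heq hM hP hA₁ hI

end Rounds

end LocalEnergyRescue

end Summit.NavierStokesRegularity.NavierStokesRegularity.Theorems.CoriolisHead

end
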